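import Literature.AlgebraicTopology.SingularHomology.GysinMap
import Literature.AlgebraicTopology.SingularHomology.PoincareDualityCorollaries
import Literature.AlgebraicTopology.SingularHomology.FundamentalClassProofs
import Literature.AlgebraicTopology.SingularHomology.CupProductSupports
import Literature.AlgebraicTopology.SingularHomology.UniversalCoefficientsField
import HarnessLib

/-!
# The Poincaré-duality transposition of Gysin images into pull-backs (Deligne, Hodge III,
# proof of Cor. 8.2.8), over a field

P. Deligne, *Théorie de Hodge III* (1974), proof of Cor. 8.2.8 (p. 40): "(8.2.8.1)
`H˙(X̃) →^{q_*} H˙(Y) → H˙(U)` est la suite transposée de (8.2.8.2) `H˙_c(U) → H˙(Y) →^{q^*} H˙(X̃)`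
par dualité de Poincaré". This file proves that transposition for the tree's Gysin homomorphisms
`f_! = D_X⁻¹ ∘ f_* ∘ D_Y` (`GysinMap.lean`) of maps `f j : Y j → X` of closed oriented manifolds
over a FIELD `F`, in the following Čech form which needs neither compactly supported cohomology
nor the cohomology of a singular subspace: for `K ⊆ X` closed and `b + q = n`,

  IF every `x' ∈ Hᵠ(X; F)` killed by all the pull-backs `(f j)^*` vanishes on some open
  neighbourhood of `K`, THEN `ker (Hᵇ(X; F) → Hᵇ(X ∖ K; F)) ⊆ Σ_j im ((f j)_! : Hᵃ(Y j) → Hᵇ(X))`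

(`ker_map_subsetIncl_compl_le_iSup_range_gysinMap`). Proof: by the perfect cup pairings of `X` and
of the `Y j` over a field (Hatcher Prop. 3.38, the tree's `isPerfPair_cupPairing_of_field_holds`,
from Poincaré duality, PROVED in the tree) a linear form on `Hᵇ(X)` vanishing on all Gysin images
is `⟨- ⌣ x', [X]⟩` with `(f j)^* x' = 0` for every `j` — because
`⟨f_! y ⌣ x', [X]⟩ = ⟨y ⌣ f^* x', [Y]⟩` (`cupPairing_gysinMap`: the projection formula
`f_!(y ⌣ f^* x') = f_! y ⌣ x'` and `⟨f_! z, [X]⟩ = ⟨z, [Y]⟩`, Fulton App. B (5)–(6)); such an `x'`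
vanishes near `K`, hence pairs to zero with every class vanishing on `X ∖ K` (cup product with
supports for the open cover `{X ∖ K, V}`, Hatcher §3.2 p. 209); conclude by `W = W⊥⊥`. In degrees
`q > dim Y j` the pull-back to `Y j` vanishes for free (`Hᵠ(Y j; F) = 0`, Hatcher Thm. 3.26(c) with
universal coefficients). The hypothesis is where, for complex varieties, Deligne's Prop. 8.2.7
(mixed Hodge theory) enters; consumer: `Literature/AlgebraicGeometry/HodgeTheory/ThomGysinClosedImmersion`.

Everything is proved; no definitions, no named facts.

## References

* [DeligneHodgeIII1974] P. Deligne, Théorie de Hodge III, Publ. Math. IHÉS 44 (1974), Cor. 8.2.8 (proof, p. 40).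
* [FultonYoungTableaux1997] W. Fulton, Young Tableaux, CUP 1997, App. B §B.1 (5)–(6).
* [HatcherAT2002] A. Hatcher, Algebraic Topology, CUP 2002, §3.2 p. 209, §3.3 Thm. 3.26(c), Prop. 3.38.
-/

noncomputable section

open CategoryTheory Limits Set

universe u v

namespace Literature.AlgebraicTopology.SingularHomology

/-- A class vanishing on `↥univ` vanishes (the inclusion `↥univ → Y` is a homeomorphism). [folklore] -/
theorem singularCohomology.eq_zero_of_map_subsetIncl_univ_eq_zero {R : Type v} [CommRing R]
    {Y : Type u} [TopologicalSpace Y] {k : ℕ} (c : singularCohomology R R Y k)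
    (hc : singularCohomology.map R R (subsetIncl (Set.univ : Set Y)) k c = 0) : c = 0 := by
  have he : ((Homeomorph.Set.univ Y : C(↥(Set.univ : Set Y), Y))) = subsetIncl (Set.univ : Set Y) := rfl
  have hinj : Function.Injective (singularCohomology.map R R (subsetIncl (Set.univ : Set Y)) k) := by
    rw [← he]
    exact ((forget (ModuleCat R)).mapIso
      (singularCohomology.mapIso R R (Homeomorph.Set.univ Y) k)).toEquiv.injective
  exact hinj (by rw [hc, map_zero])


/-! ### The Gysin image of the kernel of the pull-backs: the duality transposition -/

section Transpose

variable {R : Type v} [CommRing R]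
variable {X Y : Type u} [TopologicalSpace X] [TopologicalSpace Y] {m n : ℕ}

/-- **Cup products of classes with disjoint supports vanish**: if `x ∈ Hᵖ(X; R)` vanishes on the
complement of a closed `K` and `x' ∈ Hᵠ(X; R)` vanishes on an open `V ⊇ K`, then `x ⌣ x' = 0`
(cup product with supports for the open cover `{X ∖ K, V}`, Hatcher 2002, §3.2 p. 209).
[cite: HatcherAT2002, §3.2 p. 209] -/
theorem cupProduct_eq_zero_of_map_compl_eq_zero_of_map_nhd_eq_zero {K V : Set X} (hK : IsClosed K)
    (hV : IsOpen V) (hKV : K ⊆ V) {p q k : ℕ} (h : p + q = k) {x : singularCohomology R R X p}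
    {x' : singularCohomology R R X q} (hx : singularCohomology.map R R (subsetIncl Kᶜ) p x = 0)
    (hx' : singularCohomology.map R R (subsetIncl V) q x' = 0) : cupProduct h x x' = 0 := by
  refine singularCohomology.eq_zero_of_map_subsetIncl_univ_eq_zero _
    (map_cupProduct_eq_zero_of_isOpen hK.isOpen_compl hV h hx hx' fun z _ => ?_)
  by_cases hz : z ∈ K
  · exact Or.inr (hKV hz)
  · exact Or.inl hz

/-- **`⟨f_! z, [X]⟩ = ⟨z, [Y]⟩` in the top degree**: the Gysin map `Hᵐ(Y) → Hⁿ(X)` (through `H₀`)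
preserves the evaluation on the fundamental classes (`f_! z ⌢ [X] = f_* (z ⌢ [Y])` and the
augmentation is natural; Fulton, *Young Tableaux*, App. B (5)). [cite: FultonYoungTableaux1997, Appendix B §B.1 (5)] -/
theorem kroneckerPairing_gysinMap_fundamentalClass {μY : HomologicalOrientation R Y m}
    {μX : HomologicalOrientation R X n} (hX : μX.HasPoincareDuality) (f : C(Y, X))
    (hm : m + 0 = m) (hn : n + 0 = n) (z : singularCohomology R R Y m) :
    kroneckerPairing R R X n (gysinMap μY μX f hm hn z) μX.fundamentalClass =
      kroneckerPairing R R Y m z μY.fundamentalClass := by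
  rw [kroneckerPairing_apply, kroneckerPairing_apply, capProduct_gysinMap hX f hm hn z,
    ← ModuleCat.comp_apply, singularHomology.map_ε]

/-- **The cup pairing transposes the Gysin map into the pull-back**:
`⟨f_! y ⌣ x, [X]⟩ = ⟨y ⌣ f^* x, [Y]⟩` (projection formula `f_!(y ⌣ f^* x) = f_! y ⌣ x` and
`⟨f_! z, [X]⟩ = ⟨z, [Y]⟩`; Fulton App. B (5)–(6)). [cite: FultonYoungTableaux1997, Appendix B §B.1 (5)–(6)] -/
theorem cupPairing_gysinMap {μY : HomologicalOrientation R Y m} {μX : HomologicalOrientation R X n}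
    (hX : μX.HasPoincareDuality) (f : C(Y, X)) {a b q : ℕ} (ha : a + q = m) (hb : b + q = n)
    (y : singularCohomology R R Y a) (x : singularCohomology R R X q) :
    cupPairing μX hb (gysinMap μY μX f ha hb y) x =
      cupPairing μY ha y (singularCohomology.map R R f q x) := by
  rw [cupPairing_apply, cupPairing_apply,
    ← gysinMap_cupProduct_map hX f ha (Nat.add_zero m) (Nat.add_zero n) (Nat.add_zero q) ha hb hb y x,
    kroneckerPairing_gysinMap_fundamentalClass hX]

variable {F : Type v} [Field F]

/-- **The transposition by Poincaré duality (Deligne, *Hodge III*, proof of Cor. 8.2.8: "(8.2.8.1)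
est la suite transposée de (8.2.8.2) par dualité de Poincaré"), in Čech form.** Let `X` be a closed
`F`-oriented `n`-manifold over a field `F`, `K ⊆ X` closed, `Y j` closed `F`-oriented
`m j`-manifolds with maps `f j : Y j → X`, and `b + q = n`. Suppose that every `x' ∈ Hᵠ(X; F)`
killed by all pull-backs `(f j)^*` vanishes on some open neighbourhood of `K`. Then every class of
`Hᵇ(X; F)` vanishing on `X ∖ K` is a sum of Gysin images `(f j)_! y`, `y ∈ Hᵃ(Y j)`, `a + q = m j`.
Proof: by the perfect cup pairings of `X` and of the `Y j` (Hatcher Prop. 3.38 over a field) a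
linear form vanishing on all Gysin images is `⟨- ⌣ x', [X]⟩` with `(f j)^* x' = 0` for all `j`
(`cupPairing_gysinMap`), hence `x'` vanishes near `K` and pairs to zero with every class vanishing
on `X ∖ K` (cup product with supports); conclude by `W = W⊥⊥`. [cite: DeligneHodgeIII1974, Cor. 8.2.8 (proof)]
[cite: HatcherAT2002, §3.3 Prop. 3.38] -/
theorem ker_map_subsetIncl_compl_le_iSup_range_gysinMap [CompactSpace X] [T2Space X]
    [ChartedSpace (EuclideanSpace ℝ (Fin n)) X] (μX : HomologicalOrientation F X n)
    (hX : μX.HasPoincareDuality) {ι : Type*} {md : ι → ℕ} {Yf : ι → Type u}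
    [∀ j, TopologicalSpace (Yf j)] [∀ j, CompactSpace (Yf j)] [∀ j, T2Space (Yf j)]
    [∀ j, ChartedSpace (EuclideanSpace ℝ (Fin (md j))) (Yf j)]
    (μY : ∀ j, HomologicalOrientation F (Yf j) (md j)) (f : ∀ j, C(Yf j, X))
    {K : Set X} (hK : IsClosed K) {b q : ℕ} (hb : b + q = n)
    (H : ∀ x' : singularCohomology F F X q, (∀ j, singularCohomology.map F F (f j) q x' = 0) →
      ∃ V : Set X, IsOpen V ∧ K ⊆ V ∧ singularCohomology.map F F (subsetIncl V) q x' = 0) :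
    LinearMap.ker (singularCohomology.map F F (subsetIncl Kᶜ) b).hom ≤
      ⨆ (j : ι) (a : ℕ) (ha : a + q = md j), LinearMap.range (gysinMap (μY j) μX (f j) ha hb) := by
  intro x hx
  set T := ⨆ (j : ι) (a : ℕ) (ha : a + q = md j), LinearMap.range (gysinMap (μY j) μX (f j) ha hb)
    with hT
  rw [← Subspace.dualAnnihilator_dualCoannihilator_eq (W := T), Submodule.mem_dualCoannihilator]
  intro φ hφ
  -- `φ = ⟨- ⌣ x', [X]⟩`
  have hP : (cupPairing μX hb).IsPerfPair := isPerfPair_cupPairing_of_field_holds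
  obtain ⟨x', hx'⟩ := hP.bijective_right.2 φ
  -- every pull-back of `x'` vanishes
  have hpull : ∀ j, singularCohomology.map F F (f j) q x' = 0 := by
    intro j
    by_cases hj : q ≤ md j
    · have ha : (md j - q) + q = md j := Nat.sub_add_cancel hj
      have hPY : (cupPairing (μY j) ha).IsPerfPair := isPerfPair_cupPairing_of_field_holds
      apply hPY.bijective_right.1
      rw [map_zero]
      refine LinearMap.ext fun y => ?_
      rw [LinearMap.flip_apply, LinearMap.zero_apply, ← cupPairing_gysinMap hX (f j) ha hb y x']
      have hy : gysinMap (μY j) μX (f j) ha hb y ∈ T :=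
        Submodule.mem_iSup_of_mem j (Submodule.mem_iSup_of_mem (md j - q)
          (Submodule.mem_iSup_of_mem ha (LinearMap.mem_range_self _ y)))
      have := (Submodule.mem_dualAnnihilator φ).1 hφ _ hy
      rwa [← hx', LinearMap.flip_apply] at this
    · -- `H^q(Y j; F) = 0` above the dimension
      haveI := ModuleCat.subsingleton_of_isZero
        (isZero_singularHomology_of_lt_holds F F (Yf j) (md j) (not_le.1 hj))
      haveI := (kroneckerPairing_injective_of_field F (Yf j) q).subsingleton
      exact Subsingleton.elim _ _
  obtain ⟨V, hVo, hKV, hV⟩ := H x' hpull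
  rw [← hx', LinearMap.flip_apply, cupPairing_apply,
    cupProduct_eq_zero_of_map_compl_eq_zero_of_map_nhd_eq_zero hK hVo hKV hb hx hV, map_zero,
    LinearMap.zero_apply]

end Transpose

end Literature.AlgebraicTopology.SingularHomology

end
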